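import Summits.FinalStateConjecture.FinalStateConjecture.Theses.TemporalBandLiouville
import HarnessLib

/-!
# Birth skeleton — crux stmt-FinalStateConjecture-10171 `Theses.TemporalBandLiouville.BandLimitedLiouville` (C2, rank 2)
# line `birth` (skeleton registrar planner-skel-stmt-FinalStateConjecture-10171-0, 2026-08-17; BC3 of run/shared/lean/lens3/_common/BC.md)

C2 (FINITE-BAND LIOUVILLE): a vacuum metric `G` in one global harmonic coordinate system on the eternal excised
cylinder `Kerr.region a r₀` (hypothesis bundle `HYP` of the route target X: `IsMetricOn`, uniformly spacelike slices,
excision collar with `dr` timelike and inflow, `Ric = 0`, harmonic gauge, two-sided uniform `Cᵏ` bounds, stationary-rate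
fall-off) which is moreover BAND-LIMITED IN TIME (`BAND`: every `t ↦ G(x + t e₀)(v, w)` is the restriction of an entire
function of exponential type, bounded on `ℝ`) is `t`-independent on the whole cylinder.

The cut is the route's own engine list for C2 (route header, RANKED CRUXES #2 and TWO-LAYER PLAN: "Rellich per frequency
in the far zone; Tataru–Robbiano–Zuily–Hörmander time-analytic continuation wherever `∂ₜ` is timelike; in the ergo-belt
either T-conditional (zero-energy) pseudoconvexity or the Titchmarsh sieve"), ZONE BY ZONE, moving inward, plus the one
zone the header does not name but the conclusion covers (the collar behind `g^{rr} = 0`). Each stub is the crux with EXTRA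
hypotheses (so each is implied by the crux: the cut adds no falsity risk and no stub is vacuous-by-typing), typed verbatim
over the crux's own clauses and the far-zone clause of the route's support item `StaticZoneLiouville` (stmt-10175):

* `stub_farZoneLiouville` (F, RELLICH ZONE; L/XL): `HYP → BAND → ∃ r₂, G` is `t`-independent on `{ρ > r₂}`
  (`ρ = E4.spatialNorm`). Near-infinity rigidity of non-radiating fields: `h := ∂ₜG = O(ρ⁻²)` solves the `t`-differentiated
  reduced vacuum system exactly; every non-zero temporal frequency radiates unless it vanishes (Rellich–Vekua / Kato for
  Helmholtz systems with Coulomb tails), frequency `0` is excluded by boundedness of `G`. The periodic case is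
  Alexakis–Schlue (arXiv:1504.04592 Thm 1.1) / Bičák–Scholtz–Tod; the band-limited case with `t`-DEPENDENT coefficients
  (frequencies mix through `G` itself) is not in print. Why it might fail: Beurling-spectrum bookkeeping for products of
  band-limited functions near frequency `0`; the fall-off `DG = O(ρ⁻²)` is exactly the Rellich borderline for dipole-type
  static modes.
* `stub_staticSweep` (S, TIME-ANALYTIC CONTINUATION THROUGH THE STATIC ZONE; L): `HYP → BAND →` for all `r₁ r₂ c₁ > 0`, if
  on the closed shell `{ρ ≥ r₁}` the field `∂ₜ` is uniformly timelike (`G(e₀,e₀) ≤ −c₁`) and the coordinate cylinders are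
  uniformly non-characteristic (`g♯(dρ,dρ) ≥ c₁`) — the far-zone clause of `StaticZoneLiouville` verbatim — then
  `t`-independence on `{ρ > r₂}` propagates to `{ρ > r₁}`. Engine: `BAND` + uniform bounds make the coefficients of the
  linear system for `h` real-analytic in `t` uniformly (Bernstein); where `∂ₜ` is timelike the characteristic set has no
  covector annihilating `∂ₜ` (transversally elliptic case), so Tataru (doi:10.1080/03605309508821117) /
  Robbiano–Zuily / Hörmander continue `h = 0` across EVERY non-characteristic cylinder, uniformly in `t ∈ ℝ` by the
  uniform constants. Why it might fail: the quantitative (uniform-neighbourhood) form of Tataru's theorem for SYSTEMS with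
  diagonal principal part and merely `C^k`-in-`x`, analytic-in-`t` coefficients must be assembled; non-compactness in `t`.
* `stub_beltContinuation` (B, THE ERGO-BELT = the open heart of C2; open-problem): `HYP → BAND →` (stationary on every
  uniformly static shell, the OUTPUT SCHEMA of F+S) `→ G` is `t`-independent at every point where `g♯(dr,dr) > 0`
  (`r = Kerr.radius a`; the `r`-cylinders are timelike: photon region, static pockets and ergo-belt down to the surface
  `g^{rr} = 0`, which for Kerr–Schild Kerr is `{r > r₊}` exactly). Engines (route header): T-conditional / zero-energy
  pseudoconvexity of the limit's belt (Ionescu–Klainerman, Alexakis–Ionescu–Klainerman doi:10.1007/s00220-010-1072-1,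
  known near Kerr only) or the Titchmarsh sieve on the degree-8 polynomialised Einstein operator (arXiv:1810.09047,
  arXiv:2109.02187) + real-frequency linear rigidity (arXiv:1302.6902). Why it might fail: trapped ZERO-ENERGY null
  geodesics of a non-Kerr belt carry time-analytic hair invisible from the static zone; the sieve leaves Kerr–Schild /
  imaginary-homothetic top germs; the Klein–Gordon analogue is FALSE on Kerr `a ≠ 0` (barrier `KerrLinearHair`,
  Shlapentokh-Rothman clouds: band-limited, non-radiating, non-stationary) so the proof must be massless/vacuum-sensitive
  here (refuter rreview-0815T15-9-0 on item 10171).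
* `stub_collarContinuation` (K, ACROSS `g^{rr} = 0` AND INTO THE COLLAR; L/XL, partly open): `HYP → BAND →` (stationary
  wherever `g♯(dr,dr) > 0`) `→` stationary on the whole cylinder. Behind `g^{rr} = 0` the `r`-levels are null then
  spacelike (`g♯(dr,dr) ≤ −c₀` in the collar), `∂ₜ` is spacelike, and `h` is NOT determined by its (vanishing) trace on the
  characteristic surface alone: in the eternal picture the collar also borders the "left" horizon at `t → −∞` (Goursat
  data). What kills that data is the temporal band: interior hair entering from `t = −∞` is compactly supported or
  `e^{−κt}`-reparametrised in `t` at fixed `r`, hence never entire of exponential type and bounded unless constant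
  (Paley–Wiener / Liouville); mode-wise the radial equation behind a non-degenerate horizon has no solution flat at
  `g^{rr} = 0`. Why it might fail: DEGENERATE horizons of the limit (`κ = 0`, extremal-type `G`, allowed by `HYP`):
  polynomial peeling, Aretakis-type conserved charges, no red-shift — band-limited interior hair is conceivable there.

Composition `BandLimitedLiouville_of : Sig.F → Sig.S → Sig.B → Sig.K → BandLimitedLiouville` (the `Sig.*` legend = the
stub signatures verbatim, so that the implication form has admissible named binders; the registered stubs themselves are
DEF-FREE and self-contained via `open … in`) is pure logic: F gives `r₂`, S turns it into the static-shell schema, B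
reaches `{g^{rr} > 0}`, K the rest; `bandLimitedLiouville_of_stubs : BandLimitedLiouville` = the crux BY NAME, closed
modulo the four stubs. Hardest stub: B. Disproof.lean: none exists for this crux (`ledger crux ls` empty at
registration; no `_false_without_` obligations). Negatives index (1 entry, `not_UniformPhotonSphereChannels`): unrelated.
-/

set_option linter.dupNamespace false

noncomputable section

open Literature.Geometry.Lorentzian

namespace Summit.FinalStateConjecture.FinalStateConjecture.Cruxes.BandLimitedLiouville.Birth

/-! ## Legend: the four stub statements as named propositions (verbatim the registered signatures) -/

/-- Statement of `stub_farZoneLiouville` (F): under `HYP` + `BAND`, `G` is `t`-independent on `{ρ > r₂}` for some `r₂`. -/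
def Sig.stub_farZoneLiouville : Prop :=
  open Literature.Geometry.Lorentzian in ∀ (a r₀ : ℝ) (G : E4 → E4 →L[ℝ] E4 →L[ℝ] ℝ), (0 < r₀ ∧ MetricCoord.IsMetricOn G (Kerr.region a r₀ : Set E4) ∧ (∃ c₀ δ : ℝ, 0 < c₀ ∧ 0 < δ ∧ ∀ x ∈ Kerr.region a r₀, (E4.dx 0) (MetricCoord.sharpAt G x (E4.dx 0)) ≤ -c₀ ∧ (Kerr.radius a x < r₀ + δ → (fderiv ℝ (Kerr.radius a) x) (MetricCoord.sharpAt G x (fderiv ℝ (Kerr.radius a) x)) ≤ -c₀ ∧ c₀ ≤ (E4.dx 0) (MetricCoord.sharpAt G x (fderiv ℝ (Kerr.radius a) x)))) ∧ (∀ x ∈ Kerr.region a r₀, MetricCoord.ricAt G x = 0) ∧ (∀ x ∈ Kerr.region a r₀, ∑ β : Fin 4, MetricCoord.chrAt G x (MetricCoord.sharpAt G x (E4.dx β)) (E4.basisVector β) = 0) ∧ (∀ k : ℕ, ∃ C : ℝ, ∀ x ∈ Kerr.region a r₀, ‖iteratedFDeriv ℝ k G x‖ ≤ C ∧ ‖MetricCoord.sharpAt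 G x‖ ≤ C) ∧ (∃ C : ℝ, ∀ x ∈ Kerr.region a r₀, ‖G x - Minkowski.bilin‖ ≤ C / E4.spatialNorm x ∧ ‖iteratedFDeriv ℝ 1 G x‖ ≤ C / E4.spatialNorm x ^ 2 ∧ ‖iteratedFDeriv ℝ 2 G x‖ ≤ C / E4.spatialNorm x ^ 3)) → (∃ b C : ℝ, ∀ x ∈ Kerr.region a r₀, ∀ v w : E4, ∃ F : ℂ → ℂ, Differentiable ℂ F ∧ (∀ z : ℂ, ‖F z‖ ≤ C * ‖v‖ * ‖w‖ * Real.exp (b * |z.im|)) ∧ ∀ s : ℝ, F (s : ℂ) = ((G (x + s • E4.basisVector 0) v w : ℝ) : ℂ)) → ∃ r₂ : ℝ, ∀ x ∈ Kerr.region a r₀, r₂ < E4.spatialNorm x → ∀ s : ℝ, G (x + s • E4.basisVector 0) = G x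

/-- Statement of `stub_staticSweep` (S): under `HYP` + `BAND`, `t`-independence on `{ρ > r₂}` propagates down every uniformly static, uniformly non-characteristic shell `{ρ ≥ r₁}`. -/
def Sig.stub_staticSweep : Prop :=
  open Literature.Geometry.Lorentzian in ∀ (a r₀ : ℝ) (G : E4 → E4 →L[ℝ] E4 →L[ℝ] ℝ), (0 < r₀ ∧ MetricCoord.IsMetricOn G (Kerr.region a r₀ : Set E4) ∧ (∃ c₀ δ : ℝ, 0 < c₀ ∧ 0 < δ ∧ ∀ x ∈ Kerr.region a r₀, (E4.dx 0) (MetricCoord.sharpAt G x (E4.dx 0)) ≤ -c₀ ∧ (Kerr.radius a x < r₀ + δ → (fderiv ℝ (Kerr.radius a) x) (MetricCoord.sharpAt G x (fderiv ℝ (Kerr.radius a) x)) ≤ -c₀ ∧ c₀ ≤ (E4.dx 0) (MetricCoord.sharpAt G x (fderiv ℝ (Kerr.radius a) x)))) ∧ (∀ x ∈ Kerr.region a r₀, MetricCoord.ricAt G x = 0) ∧ (∀ x ∈ Kerr.region a r₀, ∑ β : Fin 4, MetricCoord.chrAt G x (MetricCoord.sharpAt G x (E4.dx β)) (E4.basisVector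 β) = 0) ∧ (∀ k : ℕ, ∃ C : ℝ, ∀ x ∈ Kerr.region a r₀, ‖iteratedFDeriv ℝ k G x‖ ≤ C ∧ ‖MetricCoord.sharpAt G x‖ ≤ C) ∧ (∃ C : ℝ, ∀ x ∈ Kerr.region a r₀, ‖G x - Minkowski.bilin‖ ≤ C / E4.spatialNorm x ∧ ‖iteratedFDeriv ℝ 1 G x‖ ≤ C / E4.spatialNorm x ^ 2 ∧ ‖iteratedFDeriv ℝ 2 G x‖ ≤ C / E4.spatialNorm x ^ 3)) → (∃ b C : ℝ, ∀ x ∈ Kerr.region a r₀, ∀ v w : E4, ∃ F : ℂ → ℂ, Differentiable ℂ F ∧ (∀ z : ℂ, ‖F z‖ ≤ C * ‖v‖ * ‖w‖ * Real.exp (b * |z.im|)) ∧ ∀ s : ℝ, F (s : ℂ) = ((G (x + s • E4.basisVector 0) v w : ℝ) : ℂ)) → ∀ r₁ r₂ c₁ : ℝ, 0 < c₁ → (∀ x ∈ Kerr.region a r₀, r₁ ≤ E4.spatialNorm x → G x (E4.basisVector 0) (E4.basisVector 0) ≤ -c₁ ∧ c₁ ≤ (fderiv ℝ E4.spatialNorm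 x) (MetricCoord.sharpAt G x (fderiv ℝ E4.spatialNorm x))) → (∀ x ∈ Kerr.region a r₀, r₂ < E4.spatialNorm x → ∀ s : ℝ, G (x + s • E4.basisVector 0) = G x) → ∀ x ∈ Kerr.region a r₀, r₁ < E4.spatialNorm x → ∀ s : ℝ, G (x + s • E4.basisVector 0) = G x

/-- Statement of `stub_beltContinuation` (B): under `HYP` + `BAND`, stationarity on all uniformly static shells propagates to every point with `g♯(dr,dr) > 0`. -/
def Sig.stub_beltContinuation : Prop :=
  open Literature.Geometry.Lorentzian in ∀ (a r₀ : ℝ) (G : E4 → E4 →L[ℝ] E4 →L[ℝ] ℝ), (0 < r₀ ∧ MetricCoord.IsMetricOn G (Kerr.region a r₀ : Set E4) ∧ (∃ c₀ δ : ℝ, 0 < c₀ ∧ 0 < δ ∧ ∀ x ∈ Kerr.region a r₀, (E4.dx 0) (MetricCoord.sharpAt G x (E4.dx 0)) ≤ -c₀ ∧ (Kerr.radius a x < r₀ + δ → (fderiv ℝ (Kerr.radius a) x) (MetricCoord.sharpAt G x (fderiv ℝ (Kerr.radius a) x)) ≤ -c₀ ∧ c₀ ≤ (E4.dx 0) (MetricCoord.sharpAt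 G x (fderiv ℝ (Kerr.radius a) x)))) ∧ (∀ x ∈ Kerr.region a r₀, MetricCoord.ricAt G x = 0) ∧ (∀ x ∈ Kerr.region a r₀, ∑ β : Fin 4, MetricCoord.chrAt G x (MetricCoord.sharpAt G x (E4.dx β)) (E4.basisVector β) = 0) ∧ (∀ k : ℕ, ∃ C : ℝ, ∀ x ∈ Kerr.region a r₀, ‖iteratedFDeriv ℝ k G x‖ ≤ C ∧ ‖MetricCoord.sharpAt G x‖ ≤ C) ∧ (∃ C : ℝ, ∀ x ∈ Kerr.region a r₀, ‖G x - Minkowski.bilin‖ ≤ C / E4.spatialNorm x ∧ ‖iteratedFDeriv ℝ 1 G x‖ ≤ C / E4.spatialNorm x ^ 2 ∧ ‖iteratedFDeriv ℝ 2 G x‖ ≤ C / E4.spatialNorm x ^ 3)) → (∃ b C : ℝ, ∀ x ∈ Kerr.region a r₀, ∀ v w : E4, ∃ F : ℂ → ℂ, Differentiable ℂ F ∧ (∀ z : ℂ, ‖F z‖ ≤ C * ‖v‖ * ‖w‖ * Real.exp (b * |z.im|)) ∧ ∀ s : ℝ, F (s : ℂ) = ((G (x + s • E4.basisVector 0) v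 w : ℝ) : ℂ)) → (∀ r₁ c₁ : ℝ, 0 < c₁ → (∀ x ∈ Kerr.region a r₀, r₁ ≤ E4.spatialNorm x → G x (E4.basisVector 0) (E4.basisVector 0) ≤ -c₁ ∧ c₁ ≤ (fderiv ℝ E4.spatialNorm x) (MetricCoord.sharpAt G x (fderiv ℝ E4.spatialNorm x))) → ∀ x ∈ Kerr.region a r₀, r₁ < E4.spatialNorm x → ∀ s : ℝ, G (x + s • E4.basisVector 0) = G x) → ∀ x ∈ Kerr.region a r₀, 0 < (fderiv ℝ (Kerr.radius a) x) (MetricCoord.sharpAt G x (fderiv ℝ (Kerr.radius a) x)) → ∀ s : ℝ, G (x + s • E4.basisVector 0) = G x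

/-- Statement of `stub_collarContinuation` (K): under `HYP` + `BAND`, stationarity on `{g♯(dr,dr) > 0}` propagates to the whole cylinder. -/
def Sig.stub_collarContinuation : Prop :=
  open Literature.Geometry.Lorentzian in ∀ (a r₀ : ℝ) (G : E4 → E4 →L[ℝ] E4 →L[ℝ] ℝ), (0 < r₀ ∧ MetricCoord.IsMetricOn G (Kerr.region a r₀ : Set E4) ∧ (∃ c₀ δ : ℝ, 0 < c₀ ∧ 0 < δ ∧ ∀ x ∈ Kerr.region a r₀, (E4.dx 0) (MetricCoord.sharpAt G x (E4.dx 0)) ≤ -c₀ ∧ (Kerr.radius a x < r₀ + δ → (fderiv ℝ (Kerr.radius a) x) (MetricCoord.sharpAt G x (fderiv ℝ (Kerr.radius a) x)) ≤ -c₀ ∧ c₀ ≤ (E4.dx 0) (MetricCoord.sharpAt G x (fderiv ℝ (Kerr.radius a) x)))) ∧ (∀ x ∈ Kerr.region a r₀, MetricCoord.ricAt G x = 0) ∧ (∀ x ∈ Kerr.region a r₀, ∑ β : Fin 4, MetricCoord.chrAt G x (MetricCoord.sharpAt G x (E4.dx β)) (E4.basisVector β) = 0) ∧ (∀ k : ℕ,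 ∃ C : ℝ, ∀ x ∈ Kerr.region a r₀, ‖iteratedFDeriv ℝ k G x‖ ≤ C ∧ ‖MetricCoord.sharpAt G x‖ ≤ C) ∧ (∃ C : ℝ, ∀ x ∈ Kerr.region a r₀, ‖G x - Minkowski.bilin‖ ≤ C / E4.spatialNorm x ∧ ‖iteratedFDeriv ℝ 1 G x‖ ≤ C / E4.spatialNorm x ^ 2 ∧ ‖iteratedFDeriv ℝ 2 G x‖ ≤ C / E4.spatialNorm x ^ 3)) → (∃ b C : ℝ, ∀ x ∈ Kerr.region a r₀, ∀ v w : E4, ∃ F : ℂ → ℂ, Differentiable ℂ F ∧ (∀ z : ℂ, ‖F z‖ ≤ C * ‖v‖ * ‖w‖ * Real.exp (b * |z.im|)) ∧ ∀ s : ℝ, F (s : ℂ) = ((G (x + s • E4.basisVector 0) v w : ℝ) : ℂ)) → (∀ x ∈ Kerr.region a r₀, 0 < (fderiv ℝ (Kerr.radius a) x) (MetricCoord.sharpAt G x (fderiv ℝ (Kerr.radius a) x)) → ∀ s : ℝ, G (x + s • E4.basisVector 0) = G x) → ∀ x ∈ Kerr.region a r₀, ∀ s : ℝ, G (x + s • E4.basisVector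 0) = G x

/-! ## Registered stubs (`sorry` only here; signatures def-free and self-contained) -/

/-- **F — FAR-ZONE (RELLICH) LIOUVILLE, band-limited form** (route C2 engine 1; size L/XL). Under the hypothesis bundle of
the route target (harmonic-gauge vacuum components `G` on `Kerr.region a r₀`, uniformly spacelike slices, excision collar,
`Ric = 0`, harmonic gauge, uniform `Cᵏ` bounds, stationary-rate fall-off `‖G−η‖ ≤ C/ρ`, `‖DG‖ ≤ C/ρ²`, `‖D²G‖ ≤ C/ρ³`)
and band-limitation in `t`, there is `r₂` such that `G (x + s e₀) = G x` for all `x` in the region with `ρ(x) > r₂` and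
all `s`. Mechanism: `h = ∂ₜG = O(ρ⁻²)` solves the `t`-differentiated reduced vacuum system; non-zero temporal frequencies
radiate unless zero (Rellich–Vekua/Kato for Helmholtz systems with Coulomb tails; `Literature` has Rellich's lemma,
p52527), frequency `0` is excluded by boundedness of `G`; periodic case = Alexakis–Schlue arXiv:1504.04592 Thm 1.1,
Bičák–Scholtz–Tod doi:10.1088/0264-9381/27/5/055007. Why it might fail: `t`-dependent coefficients mix frequencies
(Beurling-spectrum bookkeeping near frequency `0`); `DG = O(ρ⁻²)` is the Rellich borderline for dipole-type static modes.
Sources: arXiv:1504.04592, doi:10.4310/jdg/1513998029, doi:10.1088/0264-9381/27/5/055007, ColtonKress1998 Lemma 2.11. -/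
theorem stub_farZoneLiouville : open Literature.Geometry.Lorentzian in ∀ (a r₀ : ℝ) (G : E4 → E4 →L[ℝ] E4 →L[ℝ] ℝ), (0 < r₀ ∧ MetricCoord.IsMetricOn G (Kerr.region a r₀ : Set E4) ∧ (∃ c₀ δ : ℝ, 0 < c₀ ∧ 0 < δ ∧ ∀ x ∈ Kerr.region a r₀, (E4.dx 0) (MetricCoord.sharpAt G x (E4.dx 0)) ≤ -c₀ ∧ (Kerr.radius a x < r₀ + δ → (fderiv ℝ (Kerr.radius a) x) (MetricCoord.sharpAt G x (fderiv ℝ (Kerr.radius a) x)) ≤ -c₀ ∧ c₀ ≤ (E4.dx 0) (MetricCoord.sharpAt G x (fderiv ℝ (Kerr.radius a) x)))) ∧ (∀ x ∈ Kerr.region a r₀, MetricCoord.ricAt G x = 0) ∧ (∀ x ∈ Kerr.region a r₀, ∑ β : Fin 4, MetricCoord.chrAt G x (MetricCoord.sharpAt G x (E4.dx β)) (E4.basisVector β) = 0) ∧ (∀ k : ℕ, ∃ C : ℝ, ∀ x ∈ Kerr.region a r₀, ‖iteratedFDeriv ℝ k G x‖ ≤ C ∧ ‖MetricCoord.sharpAt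 G x‖ ≤ C) ∧ (∃ C : ℝ, ∀ x ∈ Kerr.region a r₀, ‖G x - Minkowski.bilin‖ ≤ C / E4.spatialNorm x ∧ ‖iteratedFDeriv ℝ 1 G x‖ ≤ C / E4.spatialNorm x ^ 2 ∧ ‖iteratedFDeriv ℝ 2 G x‖ ≤ C / E4.spatialNorm x ^ 3)) → (∃ b C : ℝ, ∀ x ∈ Kerr.region a r₀, ∀ v w : E4, ∃ F : ℂ → ℂ, Differentiable ℂ F ∧ (∀ z : ℂ, ‖F z‖ ≤ C * ‖v‖ * ‖w‖ * Real.exp (b * |z.im|)) ∧ ∀ s : ℝ, F (s : ℂ) = ((G (x + s • E4.basisVector 0) v w : ℝ) : ℂ)) → ∃ r₂ : ℝ, ∀ x ∈ Kerr.region a r₀, r₂ < E4.spatialNorm x → ∀ s : ℝ, G (x + s • E4.basisVector 0) = G x := by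
  sorry

/-- **S — STATIC-ZONE SWEEP by time-analytic unique continuation** (route C2 engine 2 = the continuation half of the
support item `StaticZoneLiouville`, stmt-10175, in band form; size L). Under `HYP` + `BAND`: for all `r₁ r₂` and
`c₁ > 0`, if on `{x ∈ region | r₁ ≤ ρ(x)}` one has `G x e₀ e₀ ≤ −c₁` (`∂ₜ` uniformly timelike) and
`c₁ ≤ dρ(g♯ dρ)` (coordinate cylinders uniformly non-characteristic) — verbatim the far-zone clause of
`StaticZoneLiouville` — and `G` is `t`-independent on `{ρ > r₂}`, then `G` is `t`-independent on `{ρ > r₁}`.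
Mechanism: `BAND` + bounds ⇒ coefficients real-analytic in `t` with uniform radius (Bernstein); `∂ₜ` timelike ⇒ no
characteristic covector annihilates `∂ₜ` (transversally elliptic case) ⇒ Tataru doi:10.1080/03605309508821117 /
Robbiano–Zuily / Hörmander (cf. doi:10.4171/jems/854 §1.2 case (E)) continue `h = ∂ₜG = 0` across every cylinder
`{ρ = ρ'}`, `ρ' > r₁`, with a neighbourhood size uniform in `t` (uniform constants), sweeping inward from `r₂`.
Why it might fail: the quantitative uniform form of Tataru's theorem for diagonal-principal-part SYSTEMS with
`Cᵏ`-in-`x`, analytic-in-`t` coefficients on a non-compact `t`-range has to be assembled (not in Mathlib; cite request).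
Sources: doi:10.1080/03605309508821117, doi:10.4171/jems/854, arXiv:1506.04254. -/
theorem stub_staticSweep : open Literature.Geometry.Lorentzian in ∀ (a r₀ : ℝ) (G : E4 → E4 →L[ℝ] E4 →L[ℝ] ℝ), (0 < r₀ ∧ MetricCoord.IsMetricOn G (Kerr.region a r₀ : Set E4) ∧ (∃ c₀ δ : ℝ, 0 < c₀ ∧ 0 < δ ∧ ∀ x ∈ Kerr.region a r₀, (E4.dx 0) (MetricCoord.sharpAt G x (E4.dx 0)) ≤ -c₀ ∧ (Kerr.radius a x < r₀ + δ → (fderiv ℝ (Kerr.radius a) x) (MetricCoord.sharpAt G x (fderiv ℝ (Kerr.radius a) x)) ≤ -c₀ ∧ c₀ ≤ (E4.dx 0) (MetricCoord.sharpAt G x (fderiv ℝ (Kerr.radius a) x)))) ∧ (∀ x ∈ Kerr.region a r₀, MetricCoord.ricAt G x = 0) ∧ (∀ x ∈ Kerr.region a r₀, ∑ β : Fin 4, MetricCoord.chrAt G x (MetricCoord.sharpAt G x (E4.dx β)) (E4.basisVector β) = 0) ∧ (∀ k : ℕ, ∃ C : ℝ, ∀ x ∈ Kerr.region a r₀, ‖iteratedFDeriv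 ℝ k G x‖ ≤ C ∧ ‖MetricCoord.sharpAt G x‖ ≤ C) ∧ (∃ C : ℝ, ∀ x ∈ Kerr.region a r₀, ‖G x - Minkowski.bilin‖ ≤ C / E4.spatialNorm x ∧ ‖iteratedFDeriv ℝ 1 G x‖ ≤ C / E4.spatialNorm x ^ 2 ∧ ‖iteratedFDeriv ℝ 2 G x‖ ≤ C / E4.spatialNorm x ^ 3)) → (∃ b C : ℝ, ∀ x ∈ Kerr.region a r₀, ∀ v w : E4, ∃ F : ℂ → ℂ, Differentiable ℂ F ∧ (∀ z : ℂ, ‖F z‖ ≤ C * ‖v‖ * ‖w‖ * Real.exp (b * |z.im|)) ∧ ∀ s : ℝ, F (s : ℂ) = ((G (x + s • E4.basisVector 0) v w : ℝ) : ℂ)) → ∀ r₁ r₂ c₁ : ℝ, 0 < c₁ → (∀ x ∈ Kerr.region a r₀, r₁ ≤ E4.spatialNorm x → G x (E4.basisVector 0) (E4.basisVector 0) ≤ -c₁ ∧ c₁ ≤ (fderiv ℝ E4.spatialNorm x) (MetricCoord.sharpAt G x (fderiv ℝ E4.spatialNorm x))) → (∀ x ∈ Kerr.region a r₀, r₂ <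 E4.spatialNorm x → ∀ s : ℝ, G (x + s • E4.basisVector 0) = G x) → ∀ x ∈ Kerr.region a r₀, r₁ < E4.spatialNorm x → ∀ s : ℝ, G (x + s • E4.basisVector 0) = G x := by
  sorry

/-- **B — THE ERGO-BELT: from the static shells to every timelike `r`-cylinder** (route C2 engine 3, the open heart of the
crux; size open-problem). Under `HYP` + `BAND`: if `G` is `t`-independent on `{ρ > r₁}` for EVERY uniformly static,
uniformly non-characteristic shell `{ρ ≥ r₁}` (the output schema of F + S), then `G (x + s e₀) = G x` at every `x` of
the region with `0 < dr(g♯ dr)` (`r = Kerr.radius a`: the `r`-cylinder through `x` is timelike — photon region, static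
pockets and the ergo-belt, down to the surface `g^{rr} = 0`; for Kerr–Schild Kerr exactly `{r > r₊}`). Engines (route
header): zero-energy (T-conditional) pseudoconvexity of the limit's belt — Ionescu–Klainerman / Alexakis–Ionescu–
Klainerman doi:10.1007/s00220-010-1072-1, doi:10.1007/s00222-008-0146-6, known near Kerr only — feeding the same
time-analytic Carleman continuation; or the Titchmarsh sieve for the degree-8 polynomialised Einstein operator
(arXiv:1810.09047 Thm 2, 6; arXiv:2109.02187): top temporal germ in the cancellation variety, gauge germs removed by the
harmonic clause, Kerr–Schild germs killed at real frequency (arXiv:1302.6902). Why it might fail: trapped zero-energy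
null geodesics of a non-Kerr belt may carry time-analytic hair invisible from the static zone; the sieve leaves
Kerr–Schild / imaginary-homothetic top germs; the Klein–Gordon analogue is false on Kerr `a ≠ 0`
(`Literature.Barriers.FinalStateConjecture.KerrLinearHair`: Shlapentokh-Rothman clouds are band-limited, non-radiating,
non-stationary), so the argument must be vacuum/massless-sensitive exactly here. Sources: doi:10.1007/s00220-010-1072-1,
doi:10.1007/s00222-008-0146-6, arXiv:1810.09047, arXiv:2109.02187, arXiv:1302.6902, arXiv:1504.04592 p. 4. -/
theorem stub_beltContinuation : open Literature.Geometry.Lorentzian in ∀ (a r₀ : ℝ) (G : E4 → E4 →L[ℝ] E4 →L[ℝ] ℝ), (0 < r₀ ∧ MetricCoord.IsMetricOn G (Kerr.region a r₀ : Set E4) ∧ (∃ c₀ δ : ℝ, 0 < c₀ ∧ 0 < δ ∧ ∀ x ∈ Kerr.region a r₀, (E4.dx 0) (MetricCoord.sharpAt G x (E4.dx 0)) ≤ -c₀ ∧ (Kerr.radius a x < r₀ + δ → (fderiv ℝ (Kerr.radius a) x) (MetricCoord.sharpAt G x (fderiv ℝ (Kerr.radius a) x)) ≤ -c₀ ∧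 c₀ ≤ (E4.dx 0) (MetricCoord.sharpAt G x (fderiv ℝ (Kerr.radius a) x)))) ∧ (∀ x ∈ Kerr.region a r₀, MetricCoord.ricAt G x = 0) ∧ (∀ x ∈ Kerr.region a r₀, ∑ β : Fin 4, MetricCoord.chrAt G x (MetricCoord.sharpAt G x (E4.dx β)) (E4.basisVector β) = 0) ∧ (∀ k : ℕ, ∃ C : ℝ, ∀ x ∈ Kerr.region a r₀, ‖iteratedFDeriv ℝ k G x‖ ≤ C ∧ ‖MetricCoord.sharpAt G x‖ ≤ C) ∧ (∃ C : ℝ, ∀ x ∈ Kerr.region a r₀, ‖G x - Minkowski.bilin‖ ≤ C / E4.spatialNorm x ∧ ‖iteratedFDeriv ℝ 1 G x‖ ≤ C / E4.spatialNorm x ^ 2 ∧ ‖iteratedFDeriv ℝ 2 G x‖ ≤ C / E4.spatialNorm x ^ 3)) → (∃ b C : ℝ, ∀ x ∈ Kerr.region a r₀, ∀ v w : E4, ∃ F : ℂ → ℂ, Differentiable ℂ F ∧ (∀ z : ℂ, ‖F z‖ ≤ C * ‖v‖ * ‖w‖ * Real.exp (b * |z.im|)) ∧ ∀ s : ℝ,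 F (s : ℂ) = ((G (x + s • E4.basisVector 0) v w : ℝ) : ℂ)) → (∀ r₁ c₁ : ℝ, 0 < c₁ → (∀ x ∈ Kerr.region a r₀, r₁ ≤ E4.spatialNorm x → G x (E4.basisVector 0) (E4.basisVector 0) ≤ -c₁ ∧ c₁ ≤ (fderiv ℝ E4.spatialNorm x) (MetricCoord.sharpAt G x (fderiv ℝ E4.spatialNorm x))) → ∀ x ∈ Kerr.region a r₀, r₁ < E4.spatialNorm x → ∀ s : ℝ, G (x + s • E4.basisVector 0) = G x) → ∀ x ∈ Kerr.region a r₀, 0 < (fderiv ℝ (Kerr.radius a) x) (MetricCoord.sharpAt G x (fderiv ℝ (Kerr.radius a) x)) → ∀ s : ℝ, G (x + s • E4.basisVector 0) = G x := by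
  sorry

/-- **K — ACROSS `g^{rr} = 0` AND INTO THE COLLAR** (the zone the route header leaves implicit; size L/XL, partly open).
Under `HYP` + `BAND`: if `G (x + s e₀) = G x` wherever `0 < dr(g♯ dr)`, then `G` is `t`-independent on the whole of
`Kerr.region a r₀`. Behind `g^{rr} = 0` the `r`-levels turn null then spacelike (`g♯(dr,dr) ≤ −c₀` on the collar
`{r < r₀ + δ}`), `∂ₜ` is spacelike, and `h = ∂ₜG` is not determined by its vanishing trace on the characteristic surface
alone: on the eternal cylinder the collar also borders the horizon's `t → −∞` end (Goursat data, "left-horizon hair",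
which refutes nothing here only because of the band). Mechanism: interior hair entering from `t = −∞` is, at fixed `r`,
compactly supported or `e^{−κt}`-reparametrised in `t`, hence not entire of exponential type and bounded unless constant
(Paley–Wiener / Phragmén–Lindelöf–Liouville); mode-wise, behind a non-degenerate horizon the radial equation has no
non-zero solution flat at `g^{rr} = 0` (Frobenius exponents `0` and `±iω/κ`); red-shift/blue-shift energy estimates
(arXiv:0811.0354 §3.3) as the robust version. Why it might fail: DEGENERATE horizons of the limit (`κ = 0`, extremal-type
`G`, not excluded by `HYP`): polynomial peeling and Aretakis-type conserved charges (arXiv:1206.6598) — band-limited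
interior hair is conceivable there; also `{g^{rr} > 0}` need not be connected for a non-Kerr `G`.
Sources: arXiv:0811.0354, arXiv:1206.6598, arXiv:1504.04592, doi:10.1103/PhysRevD.56.4775. -/
theorem stub_collarContinuation : open Literature.Geometry.Lorentzian in ∀ (a r₀ : ℝ) (G : E4 → E4 →L[ℝ] E4 →L[ℝ] ℝ), (0 < r₀ ∧ MetricCoord.IsMetricOn G (Kerr.region a r₀ : Set E4) ∧ (∃ c₀ δ : ℝ, 0 < c₀ ∧ 0 < δ ∧ ∀ x ∈ Kerr.region a r₀, (E4.dx 0) (MetricCoord.sharpAt G x (E4.dx 0)) ≤ -c₀ ∧ (Kerr.radius a x < r₀ + δ → (fderiv ℝ (Kerr.radius a) x) (MetricCoord.sharpAt G x (fderiv ℝ (Kerr.radius a) x)) ≤ -c₀ ∧ c₀ ≤ (E4.dx 0) (MetricCoord.sharpAt G x (fderiv ℝ (Kerr.radius a) x)))) ∧ (∀ x ∈ Kerr.region a r₀, MetricCoord.ricAt G x = 0) ∧ (∀ x ∈ Kerr.region a r₀, ∑ β : Fin 4, MetricCoord.chrAt G x (MetricCoord.sharpAt G x (E4.dx β)) (E4.basisVector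 β) = 0) ∧ (∀ k : ℕ, ∃ C : ℝ, ∀ x ∈ Kerr.region a r₀, ‖iteratedFDeriv ℝ k G x‖ ≤ C ∧ ‖MetricCoord.sharpAt G x‖ ≤ C) ∧ (∃ C : ℝ, ∀ x ∈ Kerr.region a r₀, ‖G x - Minkowski.bilin‖ ≤ C / E4.spatialNorm x ∧ ‖iteratedFDeriv ℝ 1 G x‖ ≤ C / E4.spatialNorm x ^ 2 ∧ ‖iteratedFDeriv ℝ 2 G x‖ ≤ C / E4.spatialNorm x ^ 3)) → (∃ b C : ℝ, ∀ x ∈ Kerr.region a r₀, ∀ v w : E4, ∃ F : ℂ → ℂ, Differentiable ℂ F ∧ (∀ z : ℂ, ‖F z‖ ≤ C * ‖v‖ * ‖w‖ * Real.exp (b * |z.im|)) ∧ ∀ s : ℝ, F (s : ℂ) = ((G (x + s • E4.basisVector 0) v w : ℝ) : ℂ)) → (∀ x ∈ Kerr.region a r₀, 0 < (fderiv ℝ (Kerr.radius a) x) (MetricCoord.sharpAt G x (fderiv ℝ (Kerr.radius a) x)) → ∀ s : ℝ, G (x + s • E4.basisVector 0) = G x) → ∀ x ∈ Kerr.region a r₀,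 ∀ s : ℝ, G (x + s • E4.basisVector 0) = G x := by
  sorry

/-! ## Composition: the crux BY NAME from the four stubs (real proof, no `sorry`) -/

/-- **C2 from F, S, B, K** — pure logic, zone by zone: F gives a stationary far zone `{ρ > r₂}`; S propagates it down
every uniformly static, uniformly non-characteristic shell, which is exactly the schema B consumes; B reaches every
point with `g^{rr} > 0`; K carries stationarity across `g^{rr} = 0` into the collar, i.e. to the whole cylinder. -/
theorem BandLimitedLiouville_of :
    Sig.stub_farZoneLiouville → Sig.stub_staticSweep → Sig.stub_beltContinuation → Sig.stub_collarContinuation →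
      Summit.FinalStateConjecture.FinalStateConjecture.Theses.TemporalBandLiouville.BandLimitedLiouville := by
  intro hF hS hB hK a r₀ G hH hband
  obtain ⟨r₂, hr₂⟩ := hF a r₀ G hH hband
  have hshell : ∀ r₁ c₁ : ℝ, 0 < c₁ →
      (∀ x ∈ Kerr.region a r₀, r₁ ≤ E4.spatialNorm x →
        G x (E4.basisVector 0) (E4.basisVector 0) ≤ -c₁ ∧
          c₁ ≤ (fderiv ℝ E4.spatialNorm x) (MetricCoord.sharpAt G x (fderiv ℝ E4.spatialNorm x))) →
      ∀ x ∈ Kerr.region a r₀, r₁ < E4.spatialNorm x → ∀ s : ℝ, G (x + s • E4.basisVector 0) = G x :=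
    fun r₁ c₁ hc₁ hst => hS a r₀ G hH hband r₁ r₂ c₁ hc₁ hst hr₂
  exact hK a r₀ G hH hband (hB a r₀ G hH hband hshell)

/-- The crux by name, closed modulo the four registered stubs. -/
theorem bandLimitedLiouville_of_stubs :
    Summit.FinalStateConjecture.FinalStateConjecture.Theses.TemporalBandLiouville.BandLimitedLiouville :=
  BandLimitedLiouville_of stub_farZoneLiouville stub_staticSweep stub_beltContinuation stub_collarContinuation

end Summit.FinalStateConjecture.FinalStateConjecture.Cruxes.BandLimitedLiouville.Birth

end
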